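import Literature.Analysis.FluidPDE.BackwardUniquenessChainC12
import HarnessLib

/-!
# Backward uniqueness for the backward heat operator in wide cones (Li–Šverák 2012, Thm. 1.1)

L. Li, V. Šverák, *Backward uniqueness for the heat equation in cones*, Comm. PDE **37** (2012)
1414–1429 (arXiv:1011.2796). A domain `Ω ⊆ ℝⁿ` is said to have the backward uniqueness property if

  (BU) every bounded `u` on `Ω × ]0, T[` with `|∂ₜu − Δu| ≤ c₁(|u| + |∇u|)` (equivalently, for
  bounded coefficients, solving `∂ₜu − Δu + b·∇u + c u = 0` with `b`, `c` bounded measurable) and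
  `u(·, T) = 0` vanishes identically — NO condition is imposed on the lateral boundary
  `∂Ω × ]0, T[` (§1);

the half-space has (BU) (Escauriaza–Seregin–Šverák 2003, Thm. 5.1), cones of opening angle
`θ < 90°` do not (Escauriaza's example, §1), and **Theorem 1.1**: the cone
`𝒪_θ = {x | x₁ > |x| cos(θ/2)}` has (BU) for every `θ > 2 arccos(1/√3) ≈ 109.5°`; §2 restates
it, as it is proved, in backward form with `T = 1`: `|∂ₜu + Δu| ≤ c₁(|∇u| + |u|)` in `𝒪_θ × ]0,1[`,
`u(·, 0) = 0` in `𝒪_θ`, `|u| < M` imply `u ≡ 0` ((2.1)–(2.3)).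

This file vendors Theorem 1.1 as the NAMED FACT `coneBackwardUniquenessC12` (not proved in the
tree; its `κ = 0` case is the tree's theorem `Carleman.backwardUniqueness_uncurried_c12`, see
`ConeBU.halfspace`) in the vocabulary of the tree's class-`C¹₂` Carleman theory
(`FluidPDE/CarlemanCalculus`, `FluidPDE/CarlemanRegularityC12`, `FluidPDE/BackwardUniquenessChainC12`):
uncurried space–time fields `v : ℝ × ℝ³ → ℝ³` (time first), the frame operators `Carleman.dt`,
`Carleman.dx`, `Carleman.lap`, `Carleman.gradSq`, and the cone written, for a unit vector `e` and
`κ = cos(θ/2)`, as `Γ_κ(e) = {y | κ‖y‖ < ⟪y, e⟫}`, so that `θ > 2 arccos(1/√3)` (and `θ ≤ π`)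
reads `0 ≤ κ < 1/√3`, `κ = 0` being the open half-space `{⟪y, e⟫ > 0}`.

* `ConeBU κ e` — property (BU) of the cone `Γ_κ(e) ⊆ ℝ³` in the class `C¹₂`, backward form on
  `]0, 1[ × Γ_κ(e)`, for fields bounded by `1`; it is VERBATIM the backward-uniqueness hypothesis
  of the summit-side theorem `…Theorems.RellichScarApexLocalisation.stub_tracelessConeLiouville`.
* `coneBackwardUniquenessC12` — the named fact: `ConeBU κ e` for all `0 ≤ κ < 1/√3`, `‖e‖ = 1`.
* `coneBackwardUniquenessC12_iff` — the fact fully unfolded (`Iff.rfl`);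
  `coneBackwardUniquenessC12.coneBU` — the fact at given `κ`, `e`.
* `ConeBU.halfspace` — `ConeBU 0 e` is a THEOREM (ESS 2003, Thm. 5.1, in the tree:
  `Carleman.backwardUniqueness_uncurried_c12` with `Carleman.uniqueContinuation_uncurried_c12`).
* `ConeBU.of_bound` — the paper's form with an arbitrary bound `|v| ≤ M` (linearity).
* `one_div_sqrt_three_pos`, `one_div_sqrt_three_lt_one` — numerics of the critical slope.

## Rendering and faithfulness notes

* Regularity. The paper asks for "a (bounded) solution", with "no assumptions at the parabolic
  boundary" (§1), and its proof — the decay Lemma 2.2 (the ESS ball lemma, first Carleman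
  inequality (2.4)), the new Carleman inequality Prop. 2.3 applied to compactly supported
  cut-offs, and unique continuation across spatial boundaries ([ESS], Thm. 4.1) — runs in the
  framework of ESS 2003 / Seregin 2014, App. A ("sufficiently regular", e.g. (A.3.4)). The class
  used here is the tree's class `C¹₂`, in which exactly these ingredients are theorems of the tree
  (`CarlemanRegularityC12`, `BackwardUniquenessChainC12`): `v ∈ C¹` with every `∂ₑv ∈ C¹` on the
  open set, `v` continuous on `[0, 1[ × Γ` with `v(0, ·) = 0`, `∂ₜv` square integrable on bounded
  measurable subsets, and `|v| ≤ 1` (the paper's `|u| < M`; normalised using the homogeneity of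
  all hypotheses in `v`, `ConeBU.of_bound`).
* Target. (BU) is printed for scalar `u`; the restatement (2.1)–(2.3) and the two Carleman
  inequalities ((2.4), quoted there for `ℝⁿ`-valued fields, and (2.13)) are sums of squares over
  components and apply verbatim to `ℝᵐ`-valued `u`, exactly as ESS 2003, Thm. 5.1 / Seregin 2014,
  Thm. 3.5 are stated for `u : Q₊ → ℝᵐ`. The fact is stated for `ℝ³`-valued fields on `ℝ³` — the
  vorticity of a Navier–Stokes blow-up limit, the case its user needs.
* Geometry. Space dimension `n = 3`; an arbitrary unit axis `e` ("in suitable coordinates", §1);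
  `T = 1` (parabolic scaling, §2).
* Deliberately not here: the widening of the admissible angles to `θ > 2 arccos ε₀`,
  `ε₀ ≈ 0.6495`, with Gaussian growth `|u| ≤ M e^{M|x|²}` allowed (J. Wu, W. Wang, J. Differential
  Equations 258 (2015), arXiv:1310.6249, Thm. 1.1); the conjectured critical angle `π/2`; a
  general final time `T`; the monotonicity of (BU) in the domain.

## References

* L. Li, V. Šverák, *Backward uniqueness for the heat equation in cones*, Comm. Partial
  Differential Equations 37 (2012) 1414–1429, arXiv:1011.2796 — §1 (BU), Thm. 1.1, §2
  (2.1)–(2.3). [LiSverak2012]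
* L. Escauriaza, G. Seregin, V. Šverák, *`L_{3,∞}`-solutions of Navier–Stokes equations and
  backward uniqueness*, Russ. Math. Surveys 58 (2003) 211–250, Thms. 4.1, 5.1.
  [EscauriazaSereginSverak2003]
* G. Seregin, *Lecture notes on regularity theory for the Navier–Stokes equations*, World
  Scientific 2014, App. A.3, Thm. 3.5 and (A.3.1)–(A.3.4). [Seregin2014]
-/

noncomputable section

open _root_.MeasureTheory _root_.Set _root_.Metric
open scoped _root_.InnerProductSpace _root_.RealInnerProductSpace _root_.ENNReal

namespace Literature.Analysis.FluidPDE

local notation "E³" => EuclideanSpace ℝ (Fin 3)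

/-! ### The property (BU) of a cone in the class `C¹₂` -/

/-- **Property (BU) of the cone `Γ_κ(e) = {y | κ‖y‖ < ⟪y, e⟫} ⊆ ℝ³` in the class `C¹₂`**
(Li–Šverák 2012, §1 (BU), in the backward form (2.1)–(2.3) of §2, `T = 1`, bound `1`): every
`v : ℝ × ℝ³ → ℝ³` which is `C¹` with `C¹` spatial derivatives `∂_{e'}v` on `]0, 1[ × Γ_κ(e)`,
continuous on `[0, 1[ × Γ_κ(e)` with `v(0, ·) = 0` on `Γ_κ(e)`, satisfies
`|∂ₜv + Δv| ≤ c₁(|v| + |∇v|)` (`c₁ ≥ 0`) and `|v| ≤ 1` on `]0, 1[ × Γ_κ(e)`, and has `∂ₜv` square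
integrable on bounded measurable subsets of `]0, 1[ × Γ_κ(e)`, vanishes on `]0, 1[ × Γ_κ(e)`.
No condition at all is imposed on the lateral boundary. For `‖e‖ = 1`, `Γ_κ(e)` is the open cone
of axis `e` and opening angle `2 arccos κ` (`κ = 0`: the open half-space `{⟪y, e⟫ > 0}`, where the
property is the theorem `ConeBU.halfspace`; `κ ≥ 1`: empty). This is verbatim the hypothesis (BU)
of the summit-side theorem `stub_tracelessConeLiouville`.
[cite: LiSverak2012, §1 (BU) and §2 (2.1)-(2.3)] -/
def ConeBU (κ : ℝ) (e : E³) : Prop :=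
  ∀ (v : ℝ × E³ → E³) (c₁ : ℝ), 0 ≤ c₁ →
    ContDiffOn ℝ 1 v (Ioo (0 : ℝ) 1 ×ˢ {y : E³ | κ * ‖y‖ < ⟪y, e⟫}) →
    (∀ e' : E³, ContDiffOn ℝ 1 (Carleman.dx e' v) (Ioo (0 : ℝ) 1 ×ˢ {y : E³ | κ * ‖y‖ < ⟪y, e⟫})) →
    ContinuousOn v (Ico (0 : ℝ) 1 ×ˢ {y : E³ | κ * ‖y‖ < ⟪y, e⟫}) →
    (∀ y : E³, κ * ‖y‖ < ⟪y, e⟫ → v (0, y) = 0) →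
    (∀ z ∈ Ioo (0 : ℝ) 1 ×ˢ {y : E³ | κ * ‖y‖ < ⟪y, e⟫},
      ‖Carleman.dt v z + Carleman.lap v z‖ ≤ c₁ * (‖v z‖ + Real.sqrt (Carleman.gradSq v z))) →
    (∀ z ∈ Ioo (0 : ℝ) 1 ×ˢ {y : E³ | κ * ‖y‖ < ⟪y, e⟫}, ‖v z‖ ≤ 1) →
    (∀ K' ⊆ Ioo (0 : ℝ) 1 ×ˢ {y : E³ | κ * ‖y‖ < ⟪y, e⟫}, Bornology.IsBounded K' → MeasurableSet K' →
      ∫⁻ z in K', ‖Carleman.dt v z‖ₑ ^ 2 < ∞) →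
    ∀ z ∈ Ioo (0 : ℝ) 1 ×ˢ {y : E³ | κ * ‖y‖ < ⟪y, e⟫}, v z = 0

/-! ### Li–Šverák's theorem (named fact) -/

/-- **Li–Šverák 2012, Theorem 1.1 — backward uniqueness in cones of opening angle
`> 2 arccos(1/√3) ≈ 109.5°`, class `C¹₂` (named fact).** For every `0 ≤ κ < 1/√3` and every unit
vector `e ∈ ℝ³`, the open cone `Γ_κ(e) = {y | κ‖y‖ < ⟪y, e⟫}` — opening angle
`2 arccos κ ∈ ]2 arccos(1/√3), π]` — has the backward uniqueness property `ConeBU κ e`: a `C¹₂`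
field `v : ]0,1[ × Γ_κ(e) → ℝ³`, continuous up to `t = 0` with `v(0, ·) = 0`, with
`|∂ₜv + Δv| ≤ c₁(|v| + |∇v|)`, `|v| ≤ 1` and `∂ₜv ∈ L²` on bounded measurable subsets, vanishes.
Printed: "The cones `𝒪_θ` satisfy (BU) for `θ > 2 arccos(1/√3)`", `𝒪_θ = {x | x₁ > |x| cos(θ/2)}`,
for bounded solutions (§2: `|∂ₜu + Δu| ≤ c₁(|∇u| + |u|)` in `𝒪_θ × ]0,1[`, `u(·,0) = 0`, `|u| < M`
imply `u ≡ 0`); here `n = 3`, `κ = cos(θ/2)`, axis `e`, `ℝ³`-valued fields and the class `C¹₂`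
(see the module docstring). The case `κ = 0` is the theorem `ConeBU.halfspace` (ESS 2003,
Thm. 5.1). [cite: LiSverak2012, Thm. 1.1] -/
def coneBackwardUniquenessC12 : Prop :=
  ∀ κ : ℝ, 0 ≤ κ → κ < 1 / Real.sqrt 3 → ∀ e : E³, ‖e‖ = 1 → ConeBU κ e

/-- `coneBackwardUniquenessC12` fully unfolded: the statement consumed, at fixed `κ` and `e`, by
`stub_tracelessConeLiouville`. [cite: LiSverak2012, Thm. 1.1] -/
theorem coneBackwardUniquenessC12_iff :
    coneBackwardUniquenessC12 ↔
      ∀ κ : ℝ, 0 ≤ κ → κ < 1 / Real.sqrt 3 → ∀ e : E³, ‖e‖ = 1 →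
        ∀ (v : ℝ × E³ → E³) (c₁ : ℝ), 0 ≤ c₁ →
          ContDiffOn ℝ 1 v (Ioo (0 : ℝ) 1 ×ˢ {y : E³ | κ * ‖y‖ < ⟪y, e⟫}) →
          (∀ e' : E³, ContDiffOn ℝ 1 (Carleman.dx e' v) (Ioo (0 : ℝ) 1 ×ˢ {y : E³ | κ * ‖y‖ < ⟪y, e⟫})) →
          ContinuousOn v (Ico (0 : ℝ) 1 ×ˢ {y : E³ | κ * ‖y‖ < ⟪y, e⟫}) →
          (∀ y : E³, κ * ‖y‖ < ⟪y, e⟫ → v (0, y) = 0) →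
          (∀ z ∈ Ioo (0 : ℝ) 1 ×ˢ {y : E³ | κ * ‖y‖ < ⟪y, e⟫},
            ‖Carleman.dt v z + Carleman.lap v z‖ ≤ c₁ * (‖v z‖ + Real.sqrt (Carleman.gradSq v z))) →
          (∀ z ∈ Ioo (0 : ℝ) 1 ×ˢ {y : E³ | κ * ‖y‖ < ⟪y, e⟫}, ‖v z‖ ≤ 1) →
          (∀ K' ⊆ Ioo (0 : ℝ) 1 ×ˢ {y : E³ | κ * ‖y‖ < ⟪y, e⟫}, Bornology.IsBounded K' →
            MeasurableSet K' → ∫⁻ z in K', ‖Carleman.dt v z‖ₑ ^ 2 < ∞) →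
          ∀ z ∈ Ioo (0 : ℝ) 1 ×ˢ {y : E³ | κ * ‖y‖ < ⟪y, e⟫}, v z = 0 :=
  Iff.rfl

/-- The named fact at a given slope `κ ∈ [0, 1/√3[` and unit axis `e`. [cite: LiSverak2012, Thm. 1.1] -/
theorem coneBackwardUniquenessC12.coneBU (h : coneBackwardUniquenessC12) {κ : ℝ} (hκ₀ : 0 ≤ κ)
    (hκ : κ < 1 / Real.sqrt 3) {e : E³} (he : ‖e‖ = 1) : ConeBU κ e :=
  h κ hκ₀ hκ e he

/-- `0 < 1/√3`. [folklore] -/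
theorem one_div_sqrt_three_pos : 0 < 1 / Real.sqrt 3 :=
  one_div_pos.2 (Real.sqrt_pos.2 (by norm_num))

/-- `1/√3 < 1`: every admissible slope `κ < 1/√3` of Theorem 1.1 is `< 1`, so that `Γ_κ(e)` is a
nonempty open cone (narrower than the half-space when `κ > 0`, of opening angle `2 arccos κ > 109.5°`);
this feeds the hypothesis `κ < 1` of `stub_tracelessConeLiouville`. [folklore] -/
theorem one_div_sqrt_three_lt_one : 1 / Real.sqrt 3 < 1 := by
  rw [div_lt_one (Real.sqrt_pos.2 (by norm_num : (0 : ℝ) < 3))]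
  have h : Real.sqrt 1 < Real.sqrt 3 := Real.sqrt_lt_sqrt (by norm_num) (by norm_num)
  rwa [Real.sqrt_one] at h

/-! ### The half-space case is a theorem of the tree -/

/-- **(BU) for the half-space in the class `C¹₂` is a theorem** (Escauriaza–Seregin–Šverák 2003,
Thm. 5.1 = Seregin 2014, App. A.3, Thm. 3.5, proved in the tree): `ConeBU 0 e` for every unit
vector `e`. Proof: `Carleman.backwardUniqueness_uncurried_c12` on the half-space `{⟪y, e⟫ > 0}`
with growth exponent `M = 0` (`|v| ≤ 1 = e^{0·|x|²}`), its unique-continuation input being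
`Carleman.uniqueContinuation_uncurried_c12` (ESS Thm. 4.1) on `ℝ³`.
[cite: EscauriazaSereginSverak2003, Thm. 5.1] -/
theorem ConeBU.halfspace (e : E³) (he : ‖e‖ = 1) : ConeBU 0 e := by
  intro v c₁ hc₁ hv hvx hcont h0 hBH hbd hH3
  -- the degenerate cone `{0·‖y‖ < ⟪y, e⟫}` is the open half-space `{0 < ⟪y, e⟫}`
  have hset : {y : E³ | 0 * ‖y‖ < ⟪y, e⟫} = {y : E³ | 0 < ⟪y, e⟫} := by
    ext y
    simp
  rw [hset] at hv hvx hcont hBH hbd hH3 ⊢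
  have h0' : ∀ y : E³, 0 < ⟪y, e⟫ → v (0, y) = 0 := fun y hy => h0 y (by rwa [zero_mul])
  have hgrowth : ∀ z ∈ Ioo (0 : ℝ) 1 ×ˢ {y : E³ | 0 < ⟪y, e⟫}, ‖v z‖ ≤ Real.exp (0 * ‖z.2‖ ^ 2) :=
    fun z hz => by rw [zero_mul, Real.exp_zero]; exact hbd z hz
  exact Carleman.backwardUniqueness_uncurried_c12 (E := E³) (F := E³)
    (fun _ _ _ hc hR hT _ hU hUx hUc hineq hvan =>
      Carleman.uniqueContinuation_uncurried_c12 3 3 hc hR hT hU hUx hUc hineq hvan)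
    he hc₁ le_rfl hv hvx hcont h0' hBH hgrowth hH3

/-! ### The paper's form with an arbitrary bound -/

/-- `∂ₜ(c u) = c ∂ₜu` pointwise (no differentiability needed: `c` is a field element). [folklore] -/
private theorem dt_const_smul_pt (c : ℝ) (u : ℝ × E³ → E³) (z : ℝ × E³) :
    Carleman.dt (fun y => c • u y) z = c • Carleman.dt u z := by
  rw [Carleman.dt_apply, Carleman.dt_apply, show (fun y => c • u y) = c • u from rfl,
    fderiv_const_smul_field]
  rfl

/-- `∂ₑ(c u) = c ∂ₑu` as functions. [folklore] -/
private theorem dx_const_smul_fun (c : ℝ) (u : ℝ × E³ → E³) (e : E³) :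
    Carleman.dx e (fun y => c • u y) = fun z => c • Carleman.dx e u z := by
  funext z
  rw [Carleman.dx_apply, Carleman.dx_apply, show (fun y => c • u y) = c • u from rfl,
    fderiv_const_smul_field]
  rfl

/-- `Δ(c u) = c Δu` pointwise. [folklore] -/
private theorem lap_const_smul_pt (c : ℝ) (u : ℝ × E³ → E³) (z : ℝ × E³) :
    Carleman.lap (fun y => c • u y) z = c • Carleman.lap u z := by
  simp only [Carleman.lap, dx_const_smul_fun, Finset.smul_sum]

/-- `|∇(c u)|² = c² |∇u|²` pointwise. [folklore] -/
private theorem gradSq_const_smul_pt (c : ℝ) (u : ℝ × E³ → E³) (z : ℝ × E³) :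
    Carleman.gradSq (fun y => c • u y) z = c ^ 2 * Carleman.gradSq u z := by
  simp only [Carleman.gradSq, dx_const_smul_fun, norm_smul, Real.norm_eq_abs, mul_pow, sq_abs,
    Finset.mul_sum]

/-- **(BU) with an arbitrary bound** — the form printed in Li–Šverák 2012, §2 (2.3) (`|u| < M`):
if `Γ_κ(e)` has property `ConeBU κ e` (fields bounded by `1`), then every field of the same class
bounded by some `M > 0` on `]0, 1[ × Γ_κ(e)` vanishes as well — apply (BU) to `M⁻¹ v`, all
hypotheses being homogeneous in `v`. [cite: LiSverak2012, §2 (2.1)-(2.3)] -/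
theorem ConeBU.of_bound {κ : ℝ} {e : E³} (h : ConeBU κ e) {M : ℝ} (hM : 0 < M)
    (v : ℝ × E³ → E³) (c₁ : ℝ) (hc₁ : 0 ≤ c₁)
    (hv : ContDiffOn ℝ 1 v (Ioo (0 : ℝ) 1 ×ˢ {y : E³ | κ * ‖y‖ < ⟪y, e⟫}))
    (hvx : ∀ e' : E³, ContDiffOn ℝ 1 (Carleman.dx e' v) (Ioo (0 : ℝ) 1 ×ˢ {y : E³ | κ * ‖y‖ < ⟪y, e⟫}))
    (hcont : ContinuousOn v (Ico (0 : ℝ) 1 ×ˢ {y : E³ | κ * ‖y‖ < ⟪y, e⟫}))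
    (h0 : ∀ y : E³, κ * ‖y‖ < ⟪y, e⟫ → v (0, y) = 0)
    (hBH : ∀ z ∈ Ioo (0 : ℝ) 1 ×ˢ {y : E³ | κ * ‖y‖ < ⟪y, e⟫},
      ‖Carleman.dt v z + Carleman.lap v z‖ ≤ c₁ * (‖v z‖ + Real.sqrt (Carleman.gradSq v z)))
    (hbd : ∀ z ∈ Ioo (0 : ℝ) 1 ×ˢ {y : E³ | κ * ‖y‖ < ⟪y, e⟫}, ‖v z‖ ≤ M)
    (hH3 : ∀ K' ⊆ Ioo (0 : ℝ) 1 ×ˢ {y : E³ | κ * ‖y‖ < ⟪y, e⟫}, Bornology.IsBounded K' →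
      MeasurableSet K' → ∫⁻ z in K', ‖Carleman.dt v z‖ₑ ^ 2 < ∞) :
    ∀ z ∈ Ioo (0 : ℝ) 1 ×ˢ {y : E³ | κ * ‖y‖ < ⟪y, e⟫}, v z = 0 := by
  have hM0 : (0 : ℝ) ≤ M⁻¹ := inv_nonneg.2 hM.le
  -- (BU) applied to the normalised field `w = M⁻¹ v`
  have hzero := h (fun y => M⁻¹ • v y) c₁ hc₁ (hv.const_smul M⁻¹)
    (fun e' => by rw [dx_const_smul_fun]; exact (hvx e').const_smul M⁻¹)
    (hcont.const_smul M⁻¹) (fun y hy => by simp only [h0 y hy, smul_zero]) ?_ ?_ ?_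
  · intro z hz
    have h1 : M⁻¹ • v z = 0 := hzero z hz
    rcases smul_eq_zero.1 h1 with h2 | h2
    · exact absurd h2 (inv_ne_zero hM.ne')
    · exact h2
  · -- the differential inequality is homogeneous in `v`
    intro z hz
    show ‖Carleman.dt (fun y => M⁻¹ • v y) z + Carleman.lap (fun y => M⁻¹ • v y) z‖ ≤
      c₁ * (‖M⁻¹ • v z‖ + Real.sqrt (Carleman.gradSq (fun y => M⁻¹ • v y) z))
    rw [dt_const_smul_pt, lap_const_smul_pt, ← smul_add, norm_smul, norm_smul, gradSq_const_smul_pt,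
      Real.norm_eq_abs, abs_of_nonneg hM0, Real.sqrt_mul (sq_nonneg _), Real.sqrt_sq hM0]
    calc M⁻¹ * ‖Carleman.dt v z + Carleman.lap v z‖
        ≤ M⁻¹ * (c₁ * (‖v z‖ + Real.sqrt (Carleman.gradSq v z))) :=
          mul_le_mul_of_nonneg_left (hBH z hz) hM0
      _ = c₁ * (M⁻¹ * ‖v z‖ + M⁻¹ * Real.sqrt (Carleman.gradSq v z)) := by ring
  · -- the bound `1`
    intro z hz
    show ‖M⁻¹ • v z‖ ≤ 1
    rw [norm_smul, Real.norm_eq_abs, abs_of_nonneg hM0, inv_mul_le_iff₀ hM, mul_one]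
    exact hbd z hz
  · -- `∂ₜ` square integrable on bounded measurable subsets
    intro K' hK' hb hm
    have h1 : ∀ z : ℝ × E³, ‖Carleman.dt (fun y => M⁻¹ • v y) z‖ₑ ^ 2 =
        ‖(M⁻¹ : ℝ)‖ₑ ^ 2 * ‖Carleman.dt v z‖ₑ ^ 2 := by
      intro z
      rw [dt_const_smul_pt, enorm_smul, mul_pow]
    simp_rw [h1]
    rw [lintegral_const_mul' _ _ (ENNReal.pow_ne_top enorm_ne_top)]
    exact ENNReal.mul_lt_top (ENNReal.pow_lt_top enorm_lt_top) (hH3 K' hK' hb hm)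

end Literature.Analysis.FluidPDE

end
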